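import Summits.NavierStokesRegularity.NavierStokesRegularity.Theorems.TypeICertificateLadderRungReynoldsOneOseenGaugeMild
import Summits.NavierStokesRegularity.NavierStokesRegularity.Theorems.TypeICertificateLadderRungReynoldsOneOseenGaugeViscosity
import HarnessLib

/-!
# Route TypeICertificateLadder — C31-M for MILD solutions in `√ν`-units (cell pub-ns-dss; helper of
  crux stmt-NavierStokesRegularity-2882)

The mild-class Leray rate `lerayRate_frequently_gt_of_oseenMild_continuous` (unit viscosity) for a
general viscosity `ν > 0`: a jointly continuous, weakly divergence-free, slab-bounded solution of the
Oseen integral equation `u(t) = e^{ν(t−s)Δ}u(s) − B^ν_s(u,u)(t)` between all pairs of times of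
`(0,T)`, unbounded on `(0,T) × ℝ³`, satisfies `θ√ν < √(T−t)‖u(t,x)‖` frequently as `t ↑ T`, for every
`θ < 1` — the ladder sentence «`limsup_{t↑T} √((T−t)/ν)‖u(t)‖_∞ ≥ 1`» with NO classical regularity,
NO pressure, NO energy inequality, NO datum decay. Proof: the normalised field
`ũ(σ,x) = ν⁻¹u(σ/ν,x)` (`timeRescale ν⁻¹ ν⁻¹ u`, `oseen_timeRescale_of_oseen`) is in the unit-viscosity
class on `(0, νT)`.

HONEST FRAMING: statements about a HYPOTHETICAL singular time of a hypothetical mild solution; no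
such solution is asserted to exist; `1` is a perturbative threshold, nothing is said at or above it;
nothing here bears on the regularity question itself. Lands `--supports stmt-NavierStokesRegularity-2882`.
-/

noncomputable section

namespace Summit.NavierStokesRegularity.NavierStokesRegularity.Theorems

set_option linter.dupNamespace false

open MeasureTheory Set Filter Topology Function
open scoped RealInnerProductSpace ENNReal
open Literature.Analysis Literature.Analysis.FluidPDE

/-- **C31-M for mild solutions in ν-units: `θ√ν < √(T−t)‖u(t,x)‖` frequently as `t ↑ T`, for every
`θ < 1`.** Let `ν > 0`, `T > 0`, and let `u` be jointly continuous on `(0,T) × ℝ³` with weakly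
divergence-free slices, bounded on every `(0,T') × ℝ³` (`T' < T`), satisfying
`u(t) = e^{ν(t−s)Δ}u(s) − B^ν_s(u,u)(t)` pointwise between all pairs of times of `(0,T)` (KNSS gauge),
and unbounded on `(0,T) × ℝ³`. Then `∃ᶠ t → T⁻, ∃ x, θ√ν < √(T−t)‖u t x‖`. The normalisation
`ũ = timeRescale ν⁻¹ ν⁻¹ u` on `(0, νT)` is continuous, weakly divergence free (scalar multiples of
weakly divergence-free slices), slab-bounded, Oseen-mild at unit viscosity
(`oseen_timeRescale_of_oseen`) and unbounded, so `lerayRate_frequently_gt_of_oseenMild_continuous`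
applies at the time `νT`; `𝓝[<](νT)` is the image of `𝓝[<]T` under `t ↦ νt`. Nothing is claimed at
or above the threshold. [this file; KNSS 2009 §1 (1.1), Prop. 4.1, §6 + pub-ns-dss T31⁗] -/
theorem lerayRate_frequently_gt_of_oseenMild_continuous_viscosity {ν T : ℝ} (hν : 0 < ν) (hT : 0 < T)
    {u : ℝ → EuclideanSpace ℝ (Fin 3) → EuclideanSpace ℝ (Fin 3)}
    (hcont : ContinuousOn (uncurry u) (Ioo 0 T ×ˢ univ))
    (hdiv : ∀ t ∈ Ioo 0 T, IsWeaklyDivFree (u t))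
    (hbdd : ∀ T' < T, ∃ M : ℝ, ∀ t ∈ Ioo 0 T', ∀ x, ‖u t x‖ ≤ M)
    (hoseen : ∀ s t : ℝ, 0 < s → s < t → t < T → ∀ X,
      u t X = UnboundedOperators.heatExtension (u s) (ν * (t - s)) X - oseenDuhamel ν s u u t X)
    (hunb : ∀ M : ℝ, ∃ t ∈ Ioo 0 T, ∃ x, M < ‖u t x‖) {θ : ℝ} (hθ : θ < 1) :
    ∃ᶠ t in 𝓝[<] T, ∃ x, θ * Real.sqrt ν < Real.sqrt (T - t) * ‖u t x‖ := by
  have hν0 : ν ≠ 0 := hν.ne'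
  have hνinv : 0 < ν⁻¹ := inv_pos.2 hν
  set v : ℝ → EuclideanSpace ℝ (Fin 3) → EuclideanSpace ℝ (Fin 3) := timeRescale ν⁻¹ ν⁻¹ u with hvdef
  have hv : ∀ σ x, v σ x = ν⁻¹ • u (ν⁻¹ * σ) x := fun σ x => rfl
  -- the normalised field on `(0, νT)`: continuity
  have hmaps : MapsTo (fun z : ℝ × EuclideanSpace ℝ (Fin 3) => (ν⁻¹ * z.1, z.2))
      (Ioo 0 (ν * T) ×ˢ univ) (Ioo 0 T ×ˢ univ) := fun z hz =>
    ⟨(inv_mul_mem_Ioo_iff hν).2 (mem_prod.1 hz).1, mem_univ _⟩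
  have hcontv : ContinuousOn (uncurry v) (Ioo 0 (ν * T) ×ˢ univ) := by
    have hφ : Continuous fun z : ℝ × EuclideanSpace ℝ (Fin 3) => (ν⁻¹ * z.1, z.2) :=
      (continuous_fst.const_mul _).prodMk continuous_snd
    have h := (hcont.comp hφ.continuousOn hmaps).const_smul ν⁻¹
    refine h.congr fun z _ => ?_
    rfl
  -- weakly divergence-free slices
  have hdivv : ∀ σ ∈ Ioo 0 (ν * T), IsWeaklyDivFree (v σ) := by
    intro σ hσ θ' hθ'
    have h0 := hdiv (ν⁻¹ * σ) ((inv_mul_mem_Ioo_iff hν).2 hσ) θ' hθ'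
    simp only [hv, real_inner_smul_left, integral_const_mul, h0, mul_zero]
  -- slab bounds
  have hbddv : ∀ S' < ν * T, ∃ M : ℝ, ∀ σ ∈ Ioo 0 S', ∀ x, ‖v σ x‖ ≤ M := by
    intro S' hS'
    obtain ⟨M, hM⟩ := hbdd (ν⁻¹ * S') (by rw [inv_mul_lt_iff₀ hν]; exact hS')
    refine ⟨ν⁻¹ * M, fun σ hσ x => ?_⟩
    rw [hv, norm_smul, Real.norm_of_nonneg hνinv.le]
    exact mul_le_mul_of_nonneg_left
      (hM _ ⟨mul_pos hνinv hσ.1, mul_lt_mul_of_pos_left hσ.2 hνinv⟩ x) hνinv.le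
  -- the Oseen equation at unit viscosity between all pairs of `(0, νT)`
  have hoseenv : ∀ σ τ : ℝ, 0 < σ → σ < τ → τ < ν * T → ∀ X,
      v τ X = UnboundedOperators.heatExtension (v σ) (τ - σ) X - oseenDuhamel 1 σ v v τ X := by
    intro σ τ hσ hστ hτ X
    have hs : 0 < ν⁻¹ * σ := mul_pos hνinv hσ
    have hst : ν⁻¹ * σ < ν⁻¹ * τ := mul_lt_mul_of_pos_left hστ hνinv
    have ht : ν⁻¹ * τ < T := by rw [inv_mul_lt_iff₀ hν]; exact hτ
    have key := oseen_timeRescale_of_oseen hν hst.le (hoseen _ _ hs hst ht) X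
    rw [show ν * (ν⁻¹ * τ) = τ by field_simp, show ν * (ν⁻¹ * σ) = σ by field_simp] at key
    exact key
  -- unboundedness
  have hunbv : ∀ M : ℝ, ∃ σ ∈ Ioo 0 (ν * T), ∃ x, M < ‖v σ x‖ := by
    intro M
    obtain ⟨t, ht, x, hx⟩ := hunb (ν * M)
    refine ⟨ν * t, ⟨mul_pos hν ht.1, mul_lt_mul_of_pos_left ht.2 hν⟩, x, ?_⟩
    rw [hv, show ν⁻¹ * (ν * t) = t by field_simp, norm_smul, Real.norm_of_nonneg hνinv.le,
      lt_inv_mul_iff₀ hν]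
    exact hx
  -- the unit-viscosity mild theorem at time `νT`
  have h1 := lerayRate_frequently_gt_of_oseenMild_continuous (mul_pos hν hT) hcontv hdivv hbddv
    hoseenv hunbv hθ
  -- transport `𝓝[<](νT) = map (ν * ·) (𝓝[<] T)`
  have hemb : IsEmbedding fun t : ℝ => ν * t := (Homeomorph.mulLeft₀ ν hν0).isEmbedding
  have hmap : map (fun t : ℝ => ν * t) (𝓝[<] T) = 𝓝[<] (ν * T) := by
    rw [hemb.map_nhdsWithin_eq, Set.image_mul_left_Iio hν T]
  rw [← hmap, Filter.frequently_map] at h1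
  refine h1.mono fun t ⟨x, hx⟩ => ⟨x, ?_⟩
  rw [hv, show ν⁻¹ * (ν * t) = t by field_simp, norm_smul, Real.norm_of_nonneg hνinv.le,
    show ν * T - ν * t = ν * (T - t) by ring] at hx
  have hsν : 0 < Real.sqrt ν := Real.sqrt_pos.2 hν
  rcases le_or_gt (T - t) 0 with hle | hgt
  · -- degenerate times `t ≥ T`: both sides transport trivially
    have : Real.sqrt (ν * (T - t)) = 0 :=
      Real.sqrt_eq_zero'.2 (mul_nonpos_of_nonneg_of_nonpos hν.le hle)
    rw [this, zero_mul] at hx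
    have hT0 : Real.sqrt (T - t) = 0 := Real.sqrt_eq_zero'.2 hle
    rw [hT0, zero_mul]
    nlinarith [hsν]
  · rw [Real.sqrt_mul hν.le] at hx
    have hsq : Real.sqrt ν ^ 2 = ν := Real.sq_sqrt hν.le
    have e : Real.sqrt ν * Real.sqrt (T - t) * (ν⁻¹ * ‖u t x‖) =
        (Real.sqrt (T - t) * ‖u t x‖) / Real.sqrt ν := by
      rw [eq_div_iff hsν.ne']
      calc Real.sqrt ν * Real.sqrt (T - t) * (ν⁻¹ * ‖u t x‖) * Real.sqrt ν
          = (Real.sqrt ν ^ 2 * ν⁻¹) * (Real.sqrt (T - t) * ‖u t x‖) := by ring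
        _ = Real.sqrt (T - t) * ‖u t x‖ := by rw [hsq, mul_inv_cancel₀ hν0, one_mul]
    rw [e, lt_div_iff₀ hsν] at hx
    exact hx

end Summit.NavierStokesRegularity.NavierStokesRegularity.Theorems

end
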